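import Summits.Parity.GeneralizedHardyLittlewood.Theorems.DilatedTableChowla.Negative.DilatedTableChowlaScale

/-!
# `DilatedTableChowla` (stmt-Parity-14271): the normalisation is tight at the diagonal; numerics cannot reach the claim

Negative lemmas for the crux `LiouvilleShiftedTables.DilatedTableChowla` (route LiouvilleShiftedTables, X1; cdisprove seat), landed verbatim from the crux work file `Cruxes/DilatedTableChowla/Disproof.lean` (§6, §13 there) so that skeletons, ideators and provers can import them.  Notation (`rows`, `cols`, `S`, `F`, `lhs`, `crux_iff_lhs`) from `DilatedTableChowlaBlocks`. [folklore]
-/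

namespace Summit.Parity.GeneralizedHardyLittlewood.Theorems.DilatedTableChowla.Negative

open Summit.Parity.GeneralizedHardyLittlewood.Theses.LiouvilleShiftedTables
open Finset

/-! ## §6 (b) TIGHTNESS of the normalisation: three natural strengthenings are FALSE by the diagonal

The claim `x²/(log x)^C` sits exactly a factor `x^{δ/2}` (up to constants) above the diagonal
`Σ_q q³ · #rows_q · #cols_q² ≍ x^{δ/2} · x²/A`; so the (log x)^{-C} must come entirely from
DISTINCT rows, and none of the three parameters (window bottom, dilation range, weight) can be
pushed: each of the following variants is refuted by the diagonal alone (`c = 1`). -/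

/-- `⌊2N⌋₊ = 2N`. -/
theorem floor_two_mul_natCast (N : ℕ) : ⌊2 * (N : ℝ)⌋₊ = 2 * N := by
  rw [show (2 : ℝ) * (N : ℝ) = ((2 * N : ℕ) : ℝ) by push_cast; ring, Nat.floor_natCast]

/-- `N²⁴ / N = N²³` for `N ≠ 0`. -/
theorem pow24_div_self (N : ℕ) (hN : N ≠ 0) : ((N : ℝ)) ^ 24 / (N : ℝ) = (N : ℝ) ^ 23 := by
  have hN' : (N : ℝ) ≠ 0 := by exact_mod_cast hN
  rw [div_eq_iff hN', ← pow_succ]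

/-- Lower bound for `F` from lower bounds on the class sizes (`c ≥ 0`). -/
theorem F_ge_of_bounds {c : ℤ} (hc : 0 ≤ c) (x A : ℝ) (q u v : ℕ) {r k : ℝ}
    (hk0 : 0 ≤ k) (hr : r ≤ ((rows A q u).card : ℝ)) (hk : k ≤ ((cols x A q v).card : ℝ)) :
    r * k ^ 2 ≤ F c x A q u v := by
  refine le_trans ?_ (rows_mul_cols_sq_le_F hc x A q u v)
  gcongr

/-- The crux with the lower window halved: `x^{δ/2} ≤ A` instead of `x^δ ≤ A`. -/
def WithLowerWindowHalved : Prop :=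
  ∀ c : ℤ, c ≠ 0 → ∀ δ : ℝ, 0 < δ → δ ≤ 1 / 12 → ∀ C : ℝ, 0 < C → ∃ x₀ : ℝ, ∀ x : ℝ, x₀ ≤ x →
    ∀ A : ℝ, x ^ (δ / 2) ≤ A → A ≤ x ^ (1 / 3 + δ) → ∀ u v : ℕ → ℕ,
      lhs c δ x A u v ≤ x ^ 2 / Real.log x ^ C

/-- (b1) The window cannot start at `x^{δ/2}` (= the dilation range): at `A = x^{δ/2} = N` every
class `u q := 2N` has the row `a = 2N`, the columns `b ≡ 0 (q)` number `≥ N²³/(2q)`, and the diagonal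
gives `lhs ≥ Σ_{q ≤ N} q³ (N²³/(2q))² ≥ N⁴⁸/8 > x²/log x`. -/
theorem false_with_lower_window_halved : ¬ WithLowerWindowHalved := by
  intro h
  obtain ⟨x₀, hx₀⟩ := h 1 one_ne_zero (1 / 12) (by norm_num) le_rfl 1 one_pos
  obtain ⟨N, hN2, -, hxN⟩ := exists_scale x₀ 2 (by norm_num)
  have hN1 : 1 ≤ N := by omega
  have hN0 : N ≠ 0 := by omega
  have hNpos : (0 : ℝ) < N := by exact_mod_cast (by omega : 0 < N)
  set x : ℝ := ((N : ℝ)) ^ 24 with hx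
  have hQ1 : x ^ ((1 / 12 : ℝ) / 2) = N := by
    rw [hx, pow24_rpow_eq_pow N (k := 1) (by norm_num), pow_one]
  have hA1 : x ^ ((1 / 12 : ℝ) / 2) ≤ (N : ℝ) := hQ1.le
  have hA2 : (N : ℝ) ≤ x ^ (1 / 3 + 1 / 12 : ℝ) := by
    rw [hx, pow24_rpow_eq_pow N (k := 10) (by norm_num)]
    exact le_self_pow₀ (by exact_mod_cast hN1) (by norm_num)
  have key := hx₀ x hxN N hA1 hA2 (fun _ => 2 * N) (fun _ => 0)
  have hQ : ⌊x ^ ((1 / 12 : ℝ) / 2)⌋₊ = N := by rw [hQ1, Nat.floor_natCast]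
  have hfl1 : ⌊(N : ℝ)⌋₊ = N := Nat.floor_natCast N
  have hfl2 : ⌊2 * (N : ℝ)⌋₊ = 2 * N := floor_two_mul_natCast N
  have hxA : ⌊x / N⌋₊ = N ^ 23 := by rw [hx, pow24_div_self N hN0, floor_natCast_pow]
  have hterm : ∀ q ∈ Finset.Icc 1 N,
      (q : ℝ) * ((N : ℝ) ^ 46 / 4) ≤ (q : ℝ) ^ 3 * F 1 x N q (2 * N) 0 := by
    intro q hq
    obtain ⟨hq1, hqN⟩ := Finset.mem_Icc.1 hq
    have hqpos : (0 : ℝ) < q := by exact_mod_cast hq1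
    have hqN' : (q : ℝ) ≤ N := by exact_mod_cast hqN
    have hrows : (1 : ℝ) ≤ ((rows (N : ℝ) q (2 * N)).card : ℝ) :=
      one_le_card_rows_self (by rw [hfl1]; omega) (by rw [hfl2])
    have hcols := (card_cols_bounds x N q 0 hq1).1
    rw [hxA] at hcols
    push_cast at hcols
    -- `N²³/q ≥ N²² ≥ 2`, so `N²³/q - 1 ≥ N²³/(2q)`
    have hbig : (2 : ℝ) ≤ (N : ℝ) ^ 23 / q := by
      rw [le_div_iff₀ hqpos]
      have : (2 : ℝ) * q ≤ 2 * N := by linarith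
      have h22 : (2 : ℝ) * N ≤ (N : ℝ) ^ 23 := by
        have : (2 : ℝ) ≤ (N : ℝ) ^ 22 := by
          calc (2 : ℝ) ≤ N := by exact_mod_cast hN2
            _ ≤ (N : ℝ) ^ 22 := le_self_pow₀ (by exact_mod_cast hN1) (by norm_num)
        calc (2 : ℝ) * N ≤ (N : ℝ) ^ 22 * N := by gcongr
          _ = (N : ℝ) ^ 23 := by ring
      linarith
    have hcols' : (N : ℝ) ^ 23 / (2 * q) ≤ ((cols x (N : ℝ) q 0).card : ℝ) := by
      have : (N : ℝ) ^ 23 / (2 * q) = ((N : ℝ) ^ 23 / q) / 2 := by field_simp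
      rw [this]; linarith
    have hF := F_ge_of_bounds (c := 1) (by norm_num) x N q (2 * N) 0 (by positivity)
      hrows hcols'
    calc (q : ℝ) * ((N : ℝ) ^ 46 / 4) = (q : ℝ) ^ 3 * (1 * ((N : ℝ) ^ 23 / (2 * q)) ^ 2) := by
          field_simp; ring
      _ ≤ (q : ℝ) ^ 3 * F 1 x N q (2 * N) 0 := by gcongr
  have hlow : (N : ℝ) ^ 48 / 8 ≤ lhs 1 (1 / 12) x N (fun _ => 2 * N) (fun _ => 0) := by
    unfold lhs
    rw [hQ]
    calc (N : ℝ) ^ 48 / 8 = ((N : ℝ) ^ 2 / 2) * ((N : ℝ) ^ 46 / 4) := by ring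
      _ ≤ (∑ q ∈ Finset.Icc 1 N, (q : ℝ)) * ((N : ℝ) ^ 46 / 4) := by
          gcongr; exact sum_Icc_pow_one_ge N
      _ = ∑ q ∈ Finset.Icc 1 N, (q : ℝ) * ((N : ℝ) ^ 46 / 4) := by rw [Finset.sum_mul]
      _ ≤ _ := Finset.sum_le_sum hterm
  have hrhs := rhs_pow24_lt hN2
  have hpos : (0 : ℝ) ≤ (N : ℝ) ^ 48 := by positivity
  linarith

/-- Dilations up to `x^δ` instead of `x^{δ/2}`. -/
noncomputable def lhsDil (c : ℤ) (δ x A : ℝ) (u v : ℕ → ℕ) : ℝ :=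
  ∑ q ∈ Finset.Icc 1 ⌊x ^ δ⌋₊, (q : ℝ) ^ 3 * F c x A q (u q) (v q)

/-- The crux with the dilation range doubled on the log scale: `q ≤ x^δ`. -/
def WithDilationsToDelta : Prop :=
  ∀ c : ℤ, c ≠ 0 → ∀ δ : ℝ, 0 < δ → δ ≤ 1 / 12 → ∀ C : ℝ, 0 < C → ∃ x₀ : ℝ, ∀ x : ℝ, x₀ ≤ x →
    ∀ A : ℝ, x ^ δ ≤ A → A ≤ x ^ (1 / 3 + δ) → ∀ u v : ℕ → ℕ,
      lhsDil c δ x A u v ≤ x ^ 2 / Real.log x ^ C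

/-- (b2) The dilation range cannot reach the window bottom: with `q ≤ x^δ = N² = A`, classes
`u q := 2N²`, `v q := 0`, the diagonal gives `Σ_{q ≤ N²} q³ (N²²/(2q))² ≥ N⁴⁸/8 > x²/log x`. -/
theorem false_with_dilations_to_delta : ¬ WithDilationsToDelta := by
  intro h
  obtain ⟨x₀, hx₀⟩ := h 1 one_ne_zero (1 / 12) (by norm_num) le_rfl 1 one_pos
  obtain ⟨N, hN2, -, hxN⟩ := exists_scale x₀ 2 (by norm_num)
  have hN1 : 1 ≤ N := by omega
  have hN0 : N ≠ 0 := by omega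
  have hNpos : (0 : ℝ) < N := by exact_mod_cast (by omega : 0 < N)
  set x : ℝ := ((N : ℝ)) ^ 24 with hx
  have hQ1 : x ^ (1 / 12 : ℝ) = (N : ℝ) ^ 2 := by rw [hx, pow24_rpow_eq_pow N (k := 2) (by norm_num)]
  have hA1 : x ^ (1 / 12 : ℝ) ≤ (N : ℝ) ^ 2 := hQ1.le
  have hA2 : ((N : ℝ)) ^ 2 ≤ x ^ (1 / 3 + 1 / 12 : ℝ) := by
    rw [hx, pow24_rpow_eq_pow N (k := 10) (by norm_num)]
    exact pow_le_pow_right₀ (by exact_mod_cast hN1) (by norm_num)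
  have key := hx₀ x hxN ((N : ℝ) ^ 2) hA1 hA2 (fun _ => 2 * N ^ 2) (fun _ => 0)
  have hQ : ⌊x ^ (1 / 12 : ℝ)⌋₊ = N ^ 2 := by rw [hQ1, floor_natCast_pow]
  have hfl1 : ⌊((N : ℝ)) ^ 2⌋₊ = N ^ 2 := floor_natCast_pow N 2
  have hfl2 : ⌊2 * ((N : ℝ)) ^ 2⌋₊ = 2 * N ^ 2 := floor_two_mul_natCast_pow N 2
  have hxA : ⌊x / (N : ℝ) ^ 2⌋₊ = N ^ 22 := by
    rw [hx, pow24_div_pow N hN0 (by norm_num), floor_natCast_pow]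
  have hN2sq : 1 ≤ N ^ 2 := Nat.one_le_pow _ _ (by omega)
  have hterm : ∀ q ∈ Finset.Icc 1 (N ^ 2),
      (q : ℝ) * ((N : ℝ) ^ 44 / 4) ≤ (q : ℝ) ^ 3 * F 1 x ((N : ℝ) ^ 2) q (2 * N ^ 2) 0 := by
    intro q hq
    obtain ⟨hq1, hqN⟩ := Finset.mem_Icc.1 hq
    have hqpos : (0 : ℝ) < q := by exact_mod_cast hq1
    have hqN' : (q : ℝ) ≤ (N : ℝ) ^ 2 := by exact_mod_cast hqN
    have hrows : (1 : ℝ) ≤ ((rows ((N : ℝ) ^ 2) q (2 * N ^ 2)).card : ℝ) :=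
      one_le_card_rows_self (by rw [hfl1]; omega) (by rw [hfl2])
    have hcols := (card_cols_bounds x ((N : ℝ) ^ 2) q 0 hq1).1
    rw [hxA] at hcols
    push_cast at hcols
    have hbig : (2 : ℝ) ≤ (N : ℝ) ^ 22 / q := by
      rw [le_div_iff₀ hqpos]
      have h1 : (2 : ℝ) * q ≤ 2 * (N : ℝ) ^ 2 := by linarith
      have h2 : (2 : ℝ) ≤ (N : ℝ) ^ 20 := by
        calc (2 : ℝ) ≤ N := by exact_mod_cast hN2
          _ ≤ (N : ℝ) ^ 20 := le_self_pow₀ (by exact_mod_cast hN1) (by norm_num)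
      calc (2 : ℝ) * q ≤ 2 * (N : ℝ) ^ 2 := h1
        _ ≤ (N : ℝ) ^ 20 * (N : ℝ) ^ 2 := by gcongr
        _ = (N : ℝ) ^ 22 := by ring
    have hcols' : (N : ℝ) ^ 22 / (2 * q) ≤ ((cols x ((N : ℝ) ^ 2) q 0).card : ℝ) := by
      have : (N : ℝ) ^ 22 / (2 * q) = ((N : ℝ) ^ 22 / q) / 2 := by field_simp
      rw [this]; linarith
    have hF := F_ge_of_bounds (c := 1) (by norm_num) x ((N : ℝ) ^ 2) q (2 * N ^ 2) 0
      (by positivity) hrows hcols'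
    calc (q : ℝ) * ((N : ℝ) ^ 44 / 4)
          = (q : ℝ) ^ 3 * (1 * ((N : ℝ) ^ 22 / (2 * q)) ^ 2) := by field_simp; ring
      _ ≤ (q : ℝ) ^ 3 * F 1 x ((N : ℝ) ^ 2) q (2 * N ^ 2) 0 := by gcongr
  have hlow : (N : ℝ) ^ 48 / 8 ≤ lhsDil 1 (1 / 12) x ((N : ℝ) ^ 2) (fun _ => 2 * N ^ 2) (fun _ => 0) := by
    unfold lhsDil
    rw [hQ]
    calc (N : ℝ) ^ 48 / 8 = (((N ^ 2 : ℕ) : ℝ) ^ 2 / 2) * ((N : ℝ) ^ 44 / 4) := by push_cast; ring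
      _ ≤ (∑ q ∈ Finset.Icc 1 (N ^ 2), (q : ℝ)) * ((N : ℝ) ^ 44 / 4) := by
          gcongr; exact sum_Icc_pow_one_ge (N ^ 2)
      _ = ∑ q ∈ Finset.Icc 1 (N ^ 2), (q : ℝ) * ((N : ℝ) ^ 44 / 4) := by rw [Finset.sum_mul]
      _ ≤ _ := Finset.sum_le_sum hterm
  have hrhs := rhs_pow24_lt hN2
  have hpos : (0 : ℝ) ≤ (N : ℝ) ^ 48 := by positivity
  linarith

/-- Weight `q⁴` instead of `q³`. -/
noncomputable def lhs4 (c : ℤ) (δ x A : ℝ) (u v : ℕ → ℕ) : ℝ :=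
  ∑ q ∈ Finset.Icc 1 ⌊x ^ (δ / 2)⌋₊, (q : ℝ) ^ 4 * F c x A q (u q) (v q)

/-- The crux with weight `q⁴`. -/
def WithWeightFour : Prop :=
  ∀ c : ℤ, c ≠ 0 → ∀ δ : ℝ, 0 < δ → δ ≤ 1 / 12 → ∀ C : ℝ, 0 < C → ∃ x₀ : ℝ, ∀ x : ℝ, x₀ ≤ x →
    ∀ A : ℝ, x ^ δ ≤ A → A ≤ x ^ (1 / 3 + δ) → ∀ u v : ℕ → ℕ,
      lhs4 c δ x A u v ≤ x ^ 2 / Real.log x ^ C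

/-- (b3) The weight cannot be `q⁴`: with the UNIT classes `u = v = 1` (coprime to every `q`, i.e.
exactly the classes the sieve glue consumes) at `A = x^δ = N²`, rows `≥ N²/(2q)`, columns
`≥ N²²/(2q)`, the diagonal gives `Σ_{q ≤ N} q⁴ N⁴⁶/(8q³) ≥ N⁴⁸/16 > x²/log x`. So `q³` (making each
dilation's trivial bound `x²/q`) is the largest admissible weight. Class sizes do not depend on
coprimality, so restricting the crux to coprime classes changes none of (b1)–(b3). -/
theorem false_with_weight_four : ¬ WithWeightFour := by
  intro h
  obtain ⟨x₀, hx₀⟩ := h 1 one_ne_zero (1 / 12) (by norm_num) le_rfl 1 one_pos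
  obtain ⟨N, hN2, -, hxN⟩ := exists_scale x₀ 2 (by norm_num)
  have hN1 : 1 ≤ N := by omega
  have hN0 : N ≠ 0 := by omega
  have hNpos : (0 : ℝ) < N := by exact_mod_cast (by omega : 0 < N)
  set x : ℝ := ((N : ℝ)) ^ 24 with hx
  have hQ1 : x ^ ((1 / 12 : ℝ) / 2) = N := by
    rw [hx, pow24_rpow_eq_pow N (k := 1) (by norm_num), pow_one]
  have hA1 : x ^ (1 / 12 : ℝ) ≤ (N : ℝ) ^ 2 := (pow24_rpow_eq_pow N (k := 2) (by norm_num)).le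
  have hA2 : ((N : ℝ)) ^ 2 ≤ x ^ (1 / 3 + 1 / 12 : ℝ) := by
    rw [hx, pow24_rpow_eq_pow N (k := 10) (by norm_num)]
    exact pow_le_pow_right₀ (by exact_mod_cast hN1) (by norm_num)
  have key := hx₀ x hxN ((N : ℝ) ^ 2) hA1 hA2 (fun _ => 1) (fun _ => 1)
  have hQ : ⌊x ^ ((1 / 12 : ℝ) / 2)⌋₊ = N := by rw [hQ1, Nat.floor_natCast]
  have hfl1 : ⌊((N : ℝ)) ^ 2⌋₊ = N ^ 2 := floor_natCast_pow N 2
  have hfl2 : ⌊2 * ((N : ℝ)) ^ 2⌋₊ = 2 * N ^ 2 := floor_two_mul_natCast_pow N 2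
  have hxA : ⌊x / (N : ℝ) ^ 2⌋₊ = N ^ 22 := by
    rw [hx, pow24_div_pow N hN0 (by norm_num), floor_natCast_pow]
  have hterm : ∀ q ∈ Finset.Icc 1 N,
      (q : ℝ) * ((N : ℝ) ^ 46 / 8) ≤ (q : ℝ) ^ 4 * F 1 x ((N : ℝ) ^ 2) q 1 1 := by
    intro q hq
    obtain ⟨hq1, hqN⟩ := Finset.mem_Icc.1 hq
    have hqpos : (0 : ℝ) < q := by exact_mod_cast hq1
    have hqN' : (q : ℝ) ≤ N := by exact_mod_cast hqN
    have hrows := (card_rows_bounds ((N : ℝ) ^ 2) (by positivity) q 1 hq1).1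
    rw [hfl1, hfl2] at hrows
    push_cast at hrows
    have hcols := (card_cols_bounds x ((N : ℝ) ^ 2) q 1 hq1).1
    rw [hxA] at hcols
    push_cast at hcols
    have hbigr : (2 : ℝ) ≤ (N : ℝ) ^ 2 / q := by
      rw [le_div_iff₀ hqpos]
      calc (2 : ℝ) * q ≤ N * q := by gcongr; exact_mod_cast hN2
        _ ≤ N * N := by gcongr
        _ = (N : ℝ) ^ 2 := by ring
    have hbigc : (2 : ℝ) ≤ (N : ℝ) ^ 22 / q := by
      rw [le_div_iff₀ hqpos]
      calc (2 : ℝ) * q ≤ N * q := by gcongr; exact_mod_cast hN2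
        _ ≤ N * N := by gcongr
        _ = (N : ℝ) ^ 2 := by ring
        _ ≤ (N : ℝ) ^ 22 := pow_le_pow_right₀ (by exact_mod_cast hN1) (by norm_num)
    have hrows' : (N : ℝ) ^ 2 / (2 * q) ≤ ((rows ((N : ℝ) ^ 2) q 1).card : ℝ) := by
      have e : (N : ℝ) ^ 2 / (2 * q) = ((N : ℝ) ^ 2 / q) / 2 := by field_simp
      have e2 : ((2 : ℝ) * (N : ℝ) ^ 2 - (N : ℝ) ^ 2) / q = (N : ℝ) ^ 2 / q := by ring
      rw [e2] at hrows
      rw [e]; linarith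
    have hcols' : (N : ℝ) ^ 22 / (2 * q) ≤ ((cols x ((N : ℝ) ^ 2) q 1).card : ℝ) := by
      have e : (N : ℝ) ^ 22 / (2 * q) = ((N : ℝ) ^ 22 / q) / 2 := by field_simp
      rw [e]; linarith
    have hF := F_ge_of_bounds (c := 1) (by norm_num) x ((N : ℝ) ^ 2) q 1 1
      (by positivity) hrows' hcols'
    calc (q : ℝ) * ((N : ℝ) ^ 46 / 8)
          = (q : ℝ) ^ 4 * (((N : ℝ) ^ 2 / (2 * q)) * ((N : ℝ) ^ 22 / (2 * q)) ^ 2) := by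
            field_simp; ring
      _ ≤ (q : ℝ) ^ 4 * F 1 x ((N : ℝ) ^ 2) q 1 1 := by gcongr
  have hlow : (N : ℝ) ^ 48 / 16 ≤ lhs4 1 (1 / 12) x ((N : ℝ) ^ 2) (fun _ => 1) (fun _ => 1) := by
    unfold lhs4
    rw [hQ]
    calc (N : ℝ) ^ 48 / 16 = ((N : ℝ) ^ 2 / 2) * ((N : ℝ) ^ 46 / 8) := by ring
      _ ≤ (∑ q ∈ Finset.Icc 1 N, (q : ℝ)) * ((N : ℝ) ^ 46 / 8) := by
          gcongr; exact sum_Icc_pow_one_ge N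
      _ = ∑ q ∈ Finset.Icc 1 N, (q : ℝ) * ((N : ℝ) ^ 46 / 8) := by rw [Finset.sum_mul]
      _ ≤ _ := Finset.sum_le_sum hterm
  have hrhs := rhs_pow24_lt hN2
  linarith


/-! ## §13 (m) NUMERICS CANNOT REACH THE CLAIM: any admissible `x₀(c=1, δ=1/12, C=1)` exceeds `2¹⁴⁴`

At `x = 2¹⁴⁴ = 64²⁴` (`A = x^δ = 4096`, `x/A = 64²²`, dilations `q ≤ 64`) the DIAGONAL alone, with
full classes `u = v = 0`, is `≥ 64 · 4032 · (4095/4096)² · 64⁴⁴ ≈ 2.6·10⁵ · 64⁴⁴`, while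
`x²/log x = 64⁴⁸/(144 log 2) ≈ 1.7·10⁵ · 64⁴⁴`. So the crux inequality is FALSE at `x = 2¹⁴⁴ ≈ 2·10⁴³`
(and similarly at smaller dyadic scales): the threshold `x₀` lies beyond any computation; numerics
can only probe STRUCTURE (worst classes, the Bai–Yin edge of the table), never the claim itself.
For general `C` the same count pushes `x₀` past `2^{24j}` whenever `2^j < (24 j log 2)^C`
(e.g. `j ≈ 107` for `C = 10`). -/

/-- (m) **Any admissible `x₀` for `(c, δ, C) = (1, 1/12, 1)` exceeds `2¹⁴⁴`**: at `x = 2¹⁴⁴` (`N = 64`) the diagonal alone beats `x²/log x`. -/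
theorem x0_large {x₀ : ℝ}
    (hx₀ : ∀ x : ℝ, x₀ ≤ x → ∀ A : ℝ, x ^ (1 / 12 : ℝ) ≤ A → A ≤ x ^ (1 / 3 + 1 / 12 : ℝ) →
      ∀ u v : ℕ → ℕ, lhs 1 (1 / 12) x A u v ≤ x ^ 2 / Real.log x ^ (1 : ℝ)) :
    (2 : ℝ) ^ 144 < x₀ := by
  by_contra hle
  rw [not_lt] at hle
  set x : ℝ := (((64 : ℕ) : ℝ)) ^ 24 with hx
  have hx2 : (2 : ℝ) ^ 144 = x := by rw [hx]; push_cast; norm_num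
  have hxle : x₀ ≤ x := hle.trans hx2.le
  have hA1 : x ^ (1 / 12 : ℝ) ≤ (((64 : ℕ) : ℝ)) ^ 2 := (pow24_rpow_eq_pow 64 (k := 2) (by norm_num)).le
  have hA2 : (((64 : ℕ) : ℝ)) ^ 2 ≤ x ^ (1 / 3 + 1 / 12 : ℝ) := by
    rw [hx, pow24_rpow_eq_pow 64 (k := 10) (by norm_num)]
    exact pow_le_pow_right₀ (by norm_num) (by norm_num)
  have key := hx₀ x hxle ((((64 : ℕ) : ℝ)) ^ 2) hA1 hA2 (fun _ => 0) (fun _ => 0)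
  have hQ : ⌊x ^ ((1 / 12 : ℝ) / 2)⌋₊ = 64 := by
    rw [hx, pow24_rpow_eq_pow 64 (k := 1) (by norm_num), pow_one, Nat.floor_natCast]
  have hfl1 : ⌊(((64 : ℕ) : ℝ)) ^ 2⌋₊ = 64 ^ 2 := floor_natCast_pow 64 2
  have hfl2 : ⌊2 * (((64 : ℕ) : ℝ)) ^ 2⌋₊ = 2 * 64 ^ 2 := floor_two_mul_natCast_pow 64 2
  have hxA : ⌊x / (((64 : ℕ) : ℝ)) ^ 2⌋₊ = 64 ^ 22 := by
    rw [hx, pow24_div_pow 64 (by norm_num) (by norm_num), floor_natCast_pow]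
  -- the per-dilation diagonal bound (a constant `T`)
  set T : ℝ := 4032 * (4095 / 4096) ^ 2 * (64 : ℝ) ^ 44 with hT
  have hterm : ∀ q : ℕ, q ∈ Finset.Icc 1 64 →
      T ≤ (q : ℝ) ^ 3 * F 1 x ((((64 : ℕ) : ℝ)) ^ 2) q 0 0 := by
    intro q hq
    obtain ⟨hq1, hq64⟩ := Finset.mem_Icc.1 hq
    have hqpos : (0 : ℝ) < q := by exact_mod_cast hq1
    have hq64' : (q : ℝ) ≤ 64 := by exact_mod_cast hq64
    have hrows := (card_rows_bounds ((((64 : ℕ) : ℝ)) ^ 2) (by positivity) q 0 hq1).1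
    rw [hfl1, hfl2] at hrows
    have hcols := (card_cols_bounds x ((((64 : ℕ) : ℝ)) ^ 2) q 0 hq1).1
    rw [hxA] at hcols
    push_cast at hrows hcols
    -- rows ≥ 4096/q - 1 ≥ 4032/q
    have h64q : (1 : ℝ) ≤ 64 / q := by rw [one_le_div hqpos]; exact hq64'
    have erows : ((2 : ℝ) * 64 ^ 2 - 64 ^ 2) / q = 4032 / q + 64 / q := by ring
    have hrows' : (4032 : ℝ) / q ≤ ((rows ((((64 : ℕ) : ℝ)) ^ 2) q 0).card : ℝ) := by
      linarith
    -- cols ≥ 64²²/q - 1 ≥ (4095/4096) 64²²/q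
    have hbig : (1 : ℝ) ≤ (64 : ℝ) ^ 22 / (4096 * q) := by
      rw [one_le_div (by positivity)]
      calc (4096 : ℝ) * q ≤ 4096 * 64 := by gcongr
        _ ≤ (64 : ℝ) ^ 22 := by norm_num
    have ecols : (64 : ℝ) ^ 22 / (4096 * q) = (64 : ℝ) ^ 22 / q - (4095 / 4096) * ((64 : ℝ) ^ 22 / q) := by
      field_simp; ring
    have hcols' : (4095 / 4096 : ℝ) * ((64 : ℝ) ^ 22 / q) ≤ ((cols x ((((64 : ℕ) : ℝ)) ^ 2) q 0).card : ℝ) := by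
      linarith
    have hF := F_ge_of_bounds (c := 1) (by norm_num) x ((((64 : ℕ) : ℝ)) ^ 2) q 0 0 (by positivity)
      hrows' hcols'
    have hq0 : (q : ℝ) ≠ 0 := hqpos.ne'
    calc T = (q : ℝ) ^ 3 * ((4032 / q) * ((4095 / 4096 : ℝ) * ((64 : ℝ) ^ 22 / q)) ^ 2) := by
          rw [hT]; field_simp
      _ ≤ (q : ℝ) ^ 3 * F 1 x ((((64 : ℕ) : ℝ)) ^ 2) q 0 0 := by gcongr
  have hlow : 64 * T ≤ lhs 1 (1 / 12) x ((((64 : ℕ) : ℝ)) ^ 2) (fun _ => 0) (fun _ => 0) := by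
    unfold lhs
    rw [hQ]
    calc 64 * T = ∑ q ∈ Finset.Icc 1 64, T := by rw [Finset.sum_const, Nat.card_Icc]; norm_num
      _ ≤ _ := Finset.sum_le_sum hterm
  -- the right-hand side at x = 64²⁴: 64⁴⁸/(144 log 2) < 64 T
  have h2 := Real.log_two_gt_d9
  have hlog64 : Real.log (((64 : ℕ) : ℝ)) = 6 * Real.log 2 := by
    rw [show (((64 : ℕ) : ℝ)) = (2 : ℝ) ^ 6 by norm_num, Real.log_pow]; norm_num
  have hrhs : x ^ 2 / Real.log x ^ (1 : ℝ) < 64 * T := by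
    rw [Real.rpow_one, hx, ← pow_mul, log_pow24, hlog64]
    rw [div_lt_iff₀ (by linarith)]
    push_cast
    have hK : (16777216 : ℝ) < 64 * (4032 * (4095 / 4096) ^ 2) * (24 * (6 * Real.log 2)) := by
      linarith
    calc (64 : ℝ) ^ (24 * 2) = 64 ^ 44 * 16777216 := by norm_num
      _ < 64 ^ 44 * (64 * (4032 * (4095 / 4096) ^ 2) * (24 * (6 * Real.log 2))) := by gcongr
      _ = 64 * T * (24 * (6 * Real.log 2)) := by rw [hT]; ring
  linarith

end Summit.Parity.GeneralizedHardyLittlewood.Theorems.DilatedTableChowla.Negative
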